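import Literature.Computability.MetaComplexity.HeuristicClassesAmplificationProofs
import Literature.Computability.MetaComplexity.HeuristicClassesHeurBPPReductionProofs
import Literature.Computability.Complexity.PlumbingBricks
import HarnessLib

/-!
# Fair mixtures of polynomial-time samplable ensembles are polynomial-time samplable

Topic `Computability/MetaComplexity` (average-case complexity: samplable ensembles,
`DistProblems.lean`).  The fair mixture `D = ½ K₀ + ½ K₁` of two polynomial-time samplable
ensembles (`Ensemble.IsPolySamplable`, Bogdanov–Trevisan's exact `PSamp`) is polynomial-time
samplable.  In print this is a one-liner ("flip a coin, run the chosen sampler"; it is the basic step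
of every hybrid argument, Goldreich 2001 §3.2.2–3.2.3).  In the tree's model of probabilistic machines
(`RandAlg`, `Complexity/Randomized.lean`: the coin budget `coinLen` is an arbitrary, polynomially
bounded function of the input length, which the machine reads off as `|r|` — `O(log n)` bits of
advice) the mixture sampler must hand the sampler `S_b` EXACTLY `c_b(n)` coins, and the two unknown
budgets `c₀(n), c₁(n)` have to be recovered from the single number `|r|`.  We PAIR them into the
budget `1 + c₀(n) + (p₀(n) + 1) · c₁(n)` (`p₀` a polynomial bound of `c₀`, so that
`c₀ = (|r| - 1) mod B`, `c₁ = (|r| - 1) div B` with `B = p₀(n) + 1`, computed by the unary division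
brick `Plumb.divModFn`).  Contents (all proved):

* `mixEnsemble K₀ K₁` (the fair mixture), its point masses (`mixEnsemble_apply`), event
  probabilities (`toOuterMeasure_mixEnsemble`, `toOuterMeasure_le_two_mul_mixEnsemble`) and support;
* counting coin strings over cylinder sets: `cnt_drop`, `cnt_take`, `cnt_drop_take`; the point
  masses of an output law as counts, `RandAlg.toReal_outputPMF_apply`;
* the sampler `mixSampler S₀ S₁ p₀` (run map `mixRun`; as a total `FP` string function `mixStr`,
  `mixStr_mem_FP`; `isPolyTime_mixSampler`; output law `outputPMF_mixSampler`);
* **`Ensemble.isPolySamplable_mixEnsemble`** / `mixEnsemble_mem_PSamp` — `PSamp` is closed under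
  fair mixtures.

First user: the crux chain of `Summits/PneNP` route `SzkEntropy`, crux `PeaWorstToAvg` (card
`dual-mode-compile`: the hard ensemble is the mixture of an indistinguishable promise-separated pair).

## References

* O. Goldreich, *Foundations of Cryptography I: Basic Tools*, CUP 2001, §3.2.2–§3.2.3 (efficiently
  samplable ensembles, hybrids).
* A. Bogdanov, L. Trevisan, *Average-Case Complexity*, Found. Trends TCS 2 (2006), Def. 2.1 (`PSamp`).
* S. Arora, B. Barak, *Computational Complexity: A Modern Approach*, CUP 2009, Def. 7.1 (coins of a
  probabilistic machine), §1.3 (closure of polynomial time under composition).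
-/

namespace Literature.Computability.MetaComplexity

open Complexity Complexity.Brick
open _root_.Computability
open scoped ENNReal

/-! ### The fair mixture of two ensembles -/

/-- The fair mixture `½ K₀ + ½ K₁` of two ensembles: flip a fair coin `b` and draw from `K_b`.
[cite: Goldreich2001, §3.2.2] -/
noncomputable def mixEnsemble (K₀ K₁ : Ensemble) : Ensemble := fun n =>
  (PMF.uniformOfFintype Bool).bind fun b => if b then K₁ n else K₀ n

/-- Point masses of the mixture: `D_n(y) = ½ K₀,ₙ(y) + ½ K₁,ₙ(y)`. [folklore] -/
theorem mixEnsemble_apply (K₀ K₁ : Ensemble) (n : ℕ) (y : List Bool) :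
    mixEnsemble K₀ K₁ n y = 2⁻¹ * K₀ n y + 2⁻¹ * K₁ n y := by
  rw [mixEnsemble, PMF.bind_apply, tsum_bool, PMF.uniformOfFintype_apply, Fintype.card_bool]
  simp

/-- Event probabilities of the mixture: `D_n(E) = ½ K₀,ₙ(E) + ½ K₁,ₙ(E)`. [folklore] -/
theorem toOuterMeasure_mixEnsemble (K₀ K₁ : Ensemble) (n : ℕ) (E : Set (List Bool)) :
    (mixEnsemble K₀ K₁ n).toOuterMeasure E =
      2⁻¹ * (K₀ n).toOuterMeasure E + 2⁻¹ * (K₁ n).toOuterMeasure E := by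
  rw [mixEnsemble, PMF.toOuterMeasure_bind_apply, tsum_bool, PMF.uniformOfFintype_apply,
    Fintype.card_bool]
  simp

/-- The support of the mixture is the union of the supports. [folklore] -/
theorem mem_support_mixEnsemble_iff (K₀ K₁ : Ensemble) (n : ℕ) (y : List Bool) :
    y ∈ (mixEnsemble K₀ K₁ n).support ↔ y ∈ (K₀ n).support ∨ y ∈ (K₁ n).support := by
  simp only [PMF.mem_support_iff, mixEnsemble_apply, ne_eq, add_eq_zero, mul_eq_zero,
    ENNReal.inv_eq_zero, ENNReal.ofNat_ne_top, false_or, not_and_or]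

/-- Each component is dominated by twice the mixture: `K_b,ₙ(E) ≤ 2 · D_n(E)`. [folklore] -/
theorem toOuterMeasure_le_two_mul_mixEnsemble (K₀ K₁ : Ensemble) (n : ℕ) (E : Set (List Bool))
    (b : Bool) :
    ((if b then K₁ n else K₀ n).toOuterMeasure E) ≤ 2 * (mixEnsemble K₀ K₁ n).toOuterMeasure E := by
  rw [toOuterMeasure_mixEnsemble, mul_add, ← mul_assoc, ← mul_assoc,
    ENNReal.mul_inv_cancel (by norm_num) (by norm_num), one_mul, one_mul]
  cases b
  · exact le_self_add
  · exact le_add_self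

/-! ### Counting coin strings over cylinder sets -/

/-- **Skipping a prefix**: `#{t ∈ {0,1}^{a+m} | t ⇂ a ∈ E} = 2^a · #{u ∈ {0,1}^m | u ∈ E}`.
[cite: AroraBarak2009, §7.1] -/
theorem cnt_drop (a m : ℕ) (E : Set (List Bool)) :
    cnt (a + m) {t | t.drop a ∈ E} = 2 ^ a * cnt m E := by
  induction a with
  | zero => simp
  | succ a ih =>
    rw [show a + 1 + m = (a + m) + 1 by omega, cnt_succ, pow_succ]
    have h0 : {y : List Bool | false :: y ∈ {t : List Bool | t.drop (a + 1) ∈ E}} =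
        {t | t.drop a ∈ E} := rfl
    have h1 : {y : List Bool | true :: y ∈ {t : List Bool | t.drop (a + 1) ∈ E}} =
        {t | t.drop a ∈ E} := rfl
    rw [h0, h1, ih]
    ring

/-- **Ignoring a suffix**: `#{t ∈ {0,1}^{m+d} | t ↾ m ∈ E} = #{u ∈ {0,1}^m | u ∈ E} · 2^d`.
[cite: AroraBarak2009, §7.1] -/
theorem cnt_take (m d : ℕ) (E : Set (List Bool)) :
    cnt (m + d) {t | t.take m ∈ E} = cnt m E * 2 ^ d := by
  induction m generalizing E with
  | zero =>
    classical
    simp only [zero_add, List.take_zero]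
    rw [cnt_zero]
    split_ifs with h
    · rw [one_mul]
      exact cnt_eq_two_pow_of_forall fun y _ => h
    · rw [zero_mul, ← Nat.le_zero, ← not_lt]
      intro hpos
      obtain ⟨y, -, hy⟩ := (cnt_pos_iff d {t : List Bool | ([] : List Bool) ∈ E}).1 hpos
      exact h hy
  | succ m ih =>
    rw [show m + 1 + d = (m + d) + 1 by omega, cnt_succ, cnt_succ m E]
    have h0 : {y : List Bool | false :: y ∈ {t : List Bool | t.take (m + 1) ∈ E}} =
        {t | t.take m ∈ {u : List Bool | false :: u ∈ E}} := rfl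
    have h1 : {y : List Bool | true :: y ∈ {t : List Bool | t.take (m + 1) ∈ E}} =
        {t | t.take m ∈ {u : List Bool | true :: u ∈ E}} := rfl
    rw [h0, h1, ih, ih]
    ring

/-- **A window**: `#{t ∈ {0,1}^{a+c+d} | (t ⇂ a) ↾ c ∈ E} = 2^a · (#{u ∈ {0,1}^c | u ∈ E} · 2^d)`.
[cite: AroraBarak2009, §7.1] -/
theorem cnt_drop_take (a c d : ℕ) (E : Set (List Bool)) :
    cnt (a + (c + d)) {t | (t.drop a).take c ∈ E} = 2 ^ a * (cnt c E * 2 ^ d) := by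
  rw [show {t : List Bool | (t.drop a).take c ∈ E} = {t | t.drop a ∈ {u : List Bool | u.take c ∈ E}}
    from rfl, cnt_drop, cnt_take]

/-! ### Point masses of the output law of a randomized algorithm -/

/-- **The output law, pointwise, as a count**: `Pr[A(x) = b] = #{r ∈ {0,1}^c | A.run x r = b} / 2^c`
with `c = coinLen |ea x|` (real form). [cite: AroraBarak2009, §7.1] -/
theorem _root_.Literature.Computability.Complexity.RandAlg.toReal_outputPMF_apply {α β : Type} (A : RandAlg α β) (ea : α → List Bool) (x : α) (b : β) :
    (A.outputPMF ea x b).toReal =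
      (cnt (A.coinLen (ea x).length) {r | A.run x r = b} : ℝ) / 2 ^ (A.coinLen (ea x).length) := by
  rw [← PMF.toOuterMeasure_apply_singleton]
  change A.pr ea x {b} = _
  rw [RandAlg.pr_eq_uniformProb, uniformProb_eq_cnt_div]
  rfl

/-- Two `PMF`s agree as soon as their point masses agree as real numbers (all masses are finite).
[folklore] -/
theorem PMF.ext_toReal {α : Type*} {p q : PMF α} (h : ∀ a, (p a).toReal = (q a).toReal) : p = q :=
  PMF.ext fun a => (ENNReal.toReal_eq_toReal_iff' (PMF.apply_ne_top p a) (PMF.apply_ne_top q a)).1 (h a)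

/-! ### The mixture sampler -/

section Sampler

variable (S₀ S₁ : RandAlg ℕ (List Bool)) (p₀ : Polynomial ℕ)

/-- **The run map of the mixture sampler.** On `1ⁿ` with coins `r = b t`: decode the budgets
`c₀ = |t| mod B`, `c₁ = |t| div B` (`B = p₀(n) + 1`), and output `S₁(1ⁿ; (t ⇂ c₀) ↾ c₁)` if the
selector coin `b` is `1`, else `S₀(1ⁿ; t ↾ c₀)`. [cite: Goldreich2001, §3.2.2] -/
def mixRun (n : ℕ) (r : List Bool) : List Bool :=
  if r.headD false then
    S₁.run n ((r.tail.drop (r.tail.length % (p₀.eval n + 1))).take (r.tail.length / (p₀.eval n + 1)))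
  else S₀.run n (r.tail.take (r.tail.length % (p₀.eval n + 1)))

/-- **The mixture sampler**: run map `mixRun`, coin budget `1 + c₀(n) + (p₀(n) + 1) · c₁(n)` — the
two budgets PAIRED into one number, decodable because `c₀(n) ≤ p₀(n)`.
[cite: Goldreich2001, §3.2.2] -/
def mixSampler : RandAlg ℕ (List Bool) where
  run := mixRun S₀ S₁ p₀
  coinLen n := 1 + (S₀.coinLen n + (p₀.eval n + 1) * S₁.coinLen n)

/-- Decoding the paired budget: `(c₀ + B c₁) mod B = c₀` and `(c₀ + B c₁) div B = c₁` for `c₀ < B`.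
[folklore] -/
theorem pairBudget_mod_div {c₀ c₁ B : ℕ} (h : c₀ < B) :
    (c₀ + B * c₁) % B = c₀ ∧ (c₀ + B * c₁) / B = c₁ := by
  have hB : 0 < B := by omega
  exact ⟨by rw [Nat.add_mul_mod_self_left, Nat.mod_eq_of_lt h],
    by rw [Nat.add_mul_div_left _ _ hB, Nat.div_eq_of_lt h, zero_add]⟩

/-! #### The run map as a total `FP` string function -/

/-- A sampler's run map as a total string function: `w ↦ S(1^{|⟨w⟩₁|}; ⟨w⟩₂)`. [folklore] -/
def runStr (S : RandAlg ℕ (List Bool)) (w : List Bool) : List Bool := S.run (fstF w).length (sndF w)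

/-- `runStr S ∈ FP` for a polynomial-time sampler `S` (compose the machine of `S` with the
normaliser `w ↦ ⟨1^{|⟨w⟩₁|}, ⟨w⟩₂⟩`, `PolyTimeComputable.comp_holds`). [cite: AroraBarak2009, §1.3] -/
theorem runStr_mem_FP {S : RandAlg ℕ (List Bool)} (hS : S.IsPolyTime unaryEncodeNat id) :
    runStr S ∈ FP := by
  have hN : PolyTimeComputable (id : List Bool → List Bool)
      (fun p : ℕ × List Bool => boolPair (unaryEncodeNat p.1) p.2)
      (fun w => ((fstF w).length, sndF w)) :=
    PolyTimeComputable.of_encode_eq (f := fanoutFn (onesFn ∘ fstF) sndF) (ea := id) (eb := id)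
      id (fun _ => rfl) (fun w => by simp [onesFn])
      (fanoutFn_mem_FP (comp_mem_FP onesFn_mem_FP fstF_mem_FP) sndF_mem_FP)
  exact PolyTimeComputable.comp_holds hS.1 hN

/-- The coins after the selector: `w ↦ (⟨w⟩₂).tail`. [folklore] -/
noncomputable def tlF : List Bool → List Bool := List.tail ∘ sndF

/-- The selector coin as a one-bit word: `w ↦ [head ⟨w⟩₂]`. [folklore] -/
noncomputable def hdF : List Bool → List Bool := (fun r : List Bool => [r.headD false]) ∘ sndF

/-- The decoded budgets in unary: `w ↦ ⟨1^{|t| div B}, 1^{|t| mod B}⟩`, `B = p₀(|⟨w⟩₁|) + 1`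
(`Plumb.divModFn`). [folklore] -/
noncomputable def dmF : List Bool → List Bool :=
  Plumb.divModFn ∘ fanoutFn (Plumb.polyFn (p₀ + 1) ∘ fstF) (onesFn ∘ tlF)

/-- The coin block of `S₀`: `w ↦ t ↾ c₀`. [folklore] -/
noncomputable def blk0F : List Bool → List Bool := Plumb.takeFn ∘ fanoutFn (sndF ∘ dmF p₀) tlF

/-- The coin block of `S₁`: `w ↦ (t ⇂ c₀) ↾ c₁`. [folklore] -/
noncomputable def blk1F : List Bool → List Bool :=
  Plumb.takeFn ∘ fanoutFn (fstF ∘ dmF p₀) (Plumb.dropFn ∘ fanoutFn (sndF ∘ dmF p₀) tlF)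

/-- The run map of the mixture sampler as a total string function (branch on the selector coin,
`iteFn`). [folklore] -/
noncomputable def mixStr : List Bool → List Bool :=
  iteFn hdF (runStr S₁ ∘ fanoutFn fstF (blk1F p₀)) (runStr S₀ ∘ fanoutFn fstF (blk0F p₀))

/-- `dmF` decodes `⟨1^{|t| div B}, 1^{|t| mod B}⟩` on `⟨u, r⟩` (`t = tail r`, `B = p₀(|u|) + 1`). [folklore] -/
theorem dmF_boolPair (u r : List Bool) :
    dmF p₀ (boolPair u r) =
      boolPair (ones (r.tail.length / (p₀.eval u.length + 1)))
        (ones (r.tail.length % (p₀.eval u.length + 1))) := by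
  simp only [dmF, tlF, Function.comp_apply, fanoutFn_apply, fstF_boolPair, sndF_boolPair,
    Plumb.polyFn_apply, Polynomial.eval_add, Polynomial.eval_one, onesFn,
    OracleCompose.unaryEncodeNat_eq_replicate]
  exact Plumb.divModFn_boolPair _ _

/-- `blk0F` cuts `t ↾ c₀`. [folklore] -/
theorem blk0F_boolPair (u r : List Bool) :
    blk0F p₀ (boolPair u r) = r.tail.take (r.tail.length % (p₀.eval u.length + 1)) := by
  simp only [blk0F, Function.comp_apply, fanoutFn_apply, dmF_boolPair, sndF_boolPair, tlF,
    Plumb.takeFn_boolPair, List.length_replicate]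

/-- `blk1F` cuts `(t ⇂ c₀) ↾ c₁`. [folklore] -/
theorem blk1F_boolPair (u r : List Bool) :
    blk1F p₀ (boolPair u r) =
      (r.tail.drop (r.tail.length % (p₀.eval u.length + 1))).take
        (r.tail.length / (p₀.eval u.length + 1)) := by
  simp only [blk1F, Function.comp_apply, fanoutFn_apply, dmF_boolPair, fstF_boolPair, sndF_boolPair,
    tlF, Plumb.dropFn_boolPair, Plumb.takeFn_boolPair, List.length_replicate]

/-- **`mixStr` is the run map on machine words**: `mixStr ⟨1ⁿ, r⟩ = mixRun n r`. [folklore] -/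
theorem mixStr_boolPair (n : ℕ) (r : List Bool) :
    mixStr S₀ S₁ p₀ (boolPair (unaryEncodeNat n) r) = mixRun S₀ S₁ p₀ n r := by
  have hhd : hdF (boolPair (unaryEncodeNat n) r) = [r.headD false] := by
    simp [hdF]
  rw [mixStr, iteFn_apply hhd, mixRun]
  cases r.headD false
  · simp only [Bool.false_eq_true, ↓reduceIte, Function.comp_apply, fanoutFn_apply, fstF_boolPair,
      blk0F_boolPair, runStr, sndF_boolPair, OracleCompose.unaryEncodeNat_eq_replicate, List.length_replicate]
  · simp only [↓reduceIte, Function.comp_apply, fanoutFn_apply, fstF_boolPair, blk1F_boolPair, runStr,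
      sndF_boolPair, OracleCompose.unaryEncodeNat_eq_replicate, List.length_replicate]

/-- `mixStr ∈ FP` for polynomial-time samplers (closure of `FP` under composition, fan-out and
branching; leaves `runStr_mem_FP`, `Plumb.divModFn/takeFn/dropFn/polyFn`, `onesFn`, `tail`, head
bit). [cite: AroraBarak2009, §1.3] -/
theorem mixStr_mem_FP (h₀ : S₀.IsPolyTime unaryEncodeNat id) (h₁ : S₁.IsPolyTime unaryEncodeNat id) :
    mixStr S₀ S₁ p₀ ∈ FP := by
  have htl : tlF ∈ FP := comp_mem_FP PRelSigma.tail_mem_FP sndF_mem_FP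
  have hhd : hdF ∈ FP := comp_mem_FP headBitFn_mem_FP sndF_mem_FP
  have hdm : dmF p₀ ∈ FP :=
    comp_mem_FP Plumb.divModFn_mem_FP (fanoutFn_mem_FP
      (comp_mem_FP (Plumb.polyFn_mem_FP _) fstF_mem_FP) (comp_mem_FP onesFn_mem_FP htl))
  have hb0 : blk0F p₀ ∈ FP :=
    comp_mem_FP Plumb.takeFn_mem_FP (fanoutFn_mem_FP (comp_mem_FP sndF_mem_FP hdm) htl)
  have hb1 : blk1F p₀ ∈ FP :=
    comp_mem_FP Plumb.takeFn_mem_FP (fanoutFn_mem_FP (comp_mem_FP fstF_mem_FP hdm)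
      (comp_mem_FP Plumb.dropFn_mem_FP (fanoutFn_mem_FP (comp_mem_FP sndF_mem_FP hdm) htl)))
  exact iteFn_mem_FP hhd (comp_mem_FP (runStr_mem_FP h₁) (fanoutFn_mem_FP fstF_mem_FP hb1))
    (comp_mem_FP (runStr_mem_FP h₀) (fanoutFn_mem_FP fstF_mem_FP hb0))

/-- **The mixture sampler is polynomial time** (its run map is `mixStr` on machine words; coin
budget `≤ 1 + q₀ + (p₀ + 1) q₁`). [cite: AroraBarak2009, Def. 7.1] -/
theorem isPolyTime_mixSampler (h₀ : S₀.IsPolyTime unaryEncodeNat id)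
    (h₁ : S₁.IsPolyTime unaryEncodeNat id) :
    (mixSampler S₀ S₁ p₀).IsPolyTime unaryEncodeNat id := by
  obtain ⟨q₀, hq₀⟩ := h₀.2
  obtain ⟨q₁, hq₁⟩ := h₁.2
  refine ⟨PolyTimeComputable.of_encode_eq (f := mixStr S₀ S₁ p₀) (ea := id) (eb := id)
      (fun p : ℕ × List Bool => boolPair (unaryEncodeNat p.1) p.2) (fun _ => rfl)
      (fun p => by simp only [id, mixStr_boolPair]; rfl) (mixStr_mem_FP S₀ S₁ p₀ h₀ h₁),
    1 + (q₀ + (p₀ + 1) * q₁), fun n => ?_⟩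
  simp only [mixSampler, Polynomial.eval_add, Polynomial.eval_one, Polynomial.eval_mul]
  have := hq₀ n
  have := hq₁ n
  gcongr

/-! #### The output law of the mixture sampler -/

/-- **The mixture sampler samples the mixture**: if `S_b` samples `K_b` and `c₀ ≤ p₀` at `n`, then
the output law of `mixSampler` on `1ⁿ` is `½ K₀,ₙ + ½ K₁,ₙ` — counting coin strings: with
`L = c₀ + B c₁` the strings `0 t` contributing `y` number `#{u ∈ {0,1}^{c₀} | S₀(u) = y} · 2^{B c₁}`
(`cnt_take`) and the strings `1 t` number `2^{c₀} · #{u ∈ {0,1}^{c₁} | S₁(u) = y} · 2^{B c₁ - c₁}`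
(`cnt_drop_take`). [cite: Goldreich2001, §3.2.2] -/
theorem outputPMF_mixSampler {K₀ K₁ : Ensemble} (n : ℕ)
    (hK₀ : S₀.outputPMF unaryEncodeNat n = K₀ n) (hK₁ : S₁.outputPMF unaryEncodeNat n = K₁ n)
    (hc₀ : S₀.coinLen n ≤ p₀.eval n) :
    (mixSampler S₀ S₁ p₀).outputPMF unaryEncodeNat n = mixEnsemble K₀ K₁ n := by
  refine PMF.ext_toReal fun y => ?_
  rw [RandAlg.toReal_outputPMF_apply, mixEnsemble_apply, ← hK₀, ← hK₁,
    ENNReal.toReal_add (ENNReal.mul_ne_top (by simp) (PMF.apply_ne_top _ _))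
      (ENNReal.mul_ne_top (by simp) (PMF.apply_ne_top _ _)),
    ENNReal.toReal_mul, ENNReal.toReal_mul, RandAlg.toReal_outputPMF_apply, RandAlg.toReal_outputPMF_apply,
    ENNReal.toReal_inv, ENNReal.toReal_ofNat, OracleCompose.unaryEncodeNat_eq_replicate, List.length_replicate]
  -- notation
  set c₀ : ℕ := S₀.coinLen n with hc₀def
  set c₁ : ℕ := S₁.coinLen n with hc₁def
  set B : ℕ := p₀.eval n + 1 with hBdef
  set N₀ : ℕ := cnt c₀ {r | S₀.run n r = y} with hN₀
  set N₁ : ℕ := cnt c₁ {r | S₁.run n r = y} with hN₁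
  have hlt : c₀ < B := by omega
  have hmod : (c₀ + B * c₁) % (p₀.eval n + 1) = c₀ := (pairBudget_mod_div hlt).1
  have hdiv : (c₀ + B * c₁) / (p₀.eval n + 1) = c₁ := (pairBudget_mod_div hlt).2
  have hcoin : (mixSampler S₀ S₁ p₀).coinLen n = (c₀ + B * c₁) + 1 := by
    simp only [mixSampler]; ring
  rw [hcoin, cnt_succ]
  -- the two branches
  have hfalse : cnt (c₀ + B * c₁) {t : List Bool | false :: t ∈
      {r : List Bool | (mixSampler S₀ S₁ p₀).run n r = y}} = N₀ * 2 ^ (B * c₁) := by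
    rw [← cnt_take]
    refine cnt_congr fun t ht => ?_
    simp only [Set.mem_setOf_eq, mixSampler, mixRun, List.headD_cons, Bool.false_eq_true, ↓reduceIte,
      List.tail_cons, ht, hmod]
  have hsplit : c₀ + B * c₁ = c₀ + (c₁ + (B * c₁ - c₁)) := by
    have : c₁ ≤ B * c₁ := Nat.le_mul_of_pos_left c₁ (by omega)
    omega
  have htrue : cnt (c₀ + B * c₁) {t : List Bool | true :: t ∈
      {r : List Bool | (mixSampler S₀ S₁ p₀).run n r = y}} = 2 ^ c₀ * (N₁ * 2 ^ (B * c₁ - c₁)) := by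
    rw [← cnt_drop_take, ← hsplit]
    refine cnt_congr fun t ht => ?_
    simp only [Set.mem_setOf_eq, mixSampler, mixRun, List.headD_cons, ↓reduceIte, List.tail_cons, ht,
      hmod, hdiv]
  rw [hfalse, htrue]
  have h2 : (2 : ℝ) ^ (c₀ + B * c₁ + 1) = 2 ^ c₀ * 2 ^ c₁ * 2 ^ (B * c₁ - c₁) * 2 := by
    rw [hsplit]; ring
  have h3 : (2 : ℝ) ^ (B * c₁) = 2 ^ c₁ * 2 ^ (B * c₁ - c₁) := by
    rw [← pow_add]
    congr 1
    omega
  rw [h2]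
  push_cast
  rw [h3]
  field_simp

end Sampler

/-- **The fair mixture of two polynomial-time samplable ensembles is polynomial-time samplable.**
[cite: Goldreich2001, §3.2.2] -/
theorem Ensemble.isPolySamplable_mixEnsemble {K₀ K₁ : Ensemble} (h₀ : K₀.IsPolySamplable)
    (h₁ : K₁.IsPolySamplable) : (mixEnsemble K₀ K₁).IsPolySamplable := by
  obtain ⟨S₀, hS₀, hK₀⟩ := h₀
  obtain ⟨S₁, hS₁, hK₁⟩ := h₁
  obtain ⟨p₀, hp₀⟩ := hS₀.2
  exact ⟨mixSampler S₀ S₁ p₀, isPolyTime_mixSampler S₀ S₁ p₀ hS₀ hS₁, fun n =>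
    outputPMF_mixSampler S₀ S₁ p₀ n (hK₀ n) (hK₁ n) (hp₀ n)⟩

/-- `PSamp` is closed under fair mixtures. [cite: BogdanovTrevisan2006, Def. 2.1] -/
theorem mixEnsemble_mem_PSamp {K₀ K₁ : Ensemble} (h₀ : K₀ ∈ PSamp) (h₁ : K₁ ∈ PSamp) :
    mixEnsemble K₀ K₁ ∈ PSamp :=
  Ensemble.isPolySamplable_mixEnsemble h₀ h₁

end Literature.Computability.MetaComplexity
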